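import Summits.KontsevichZagierPeriods.Zeta5Search.Barrier.ConeGammaCritBoxValue

/-!
# ζ(5) search — BARRIER: CRITICAL VALUES ON BOXES — soundness IV: a certified box contains a critical point with an
# enclosed critical value

HONEST FRAMING (cell `pub-zeta5`): systematic search; no irrationality claim unless kernel-certified. Theorem only:
**`exists_isCritical_of_rootCheck`** — `rootCheck = some (l, h)` gives, for every direction `t` of the (open-box) box
with `t₀ = 1`, a CRITICAL POINT `(x, y)` of `aOfS t` (`ConeGammaRates.IsCritical`: `F₁ = F₂ = 0` and the twelve
arguments of the growth functional non-zero) whose critical value `growthLogR … x y` lies in `[l/SC, h/SC]`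
(Poincaré–Miranda zero of `ConeGammaCritBoxMiranda` + the affine enclosures of `ConeGammaCritBoxValue`; far chart:
`(x, y) = (X + t₆, 1/Z + t₆)` with `Z ≠ 0` certified, `F₁ = G₁/Z`, `F₂ = G₂/Z²`). MODEL objects under BZ (28)+(30);
nothing about any γ of record, C2 (OPEN), S-E or `ζ(5)`. Theory seat cert-2 g37.
-/

noncomputable section

open Set

namespace Summit.KontsevichZagierPeriods.Zeta5Search.Barrier.ConeGamma

namespace CritBox

open Literature.Analysis.ValidatedNumerics (AForm)
open Literature.Analysis.ValidatedNumerics.AForm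
open LemmaFBox (SC SC_pos)

variable {ε : ℕ → ℝ}

/-! ### From `rootCheck` to a critical point with an enclosed value -/

/-- **`rootCheck = some (l, h)` ⇒ a critical point of `aOfS t` with critical value in `[l/SC, h/SC]`**, for every
direction `t` of the (open-box) box with `t₀ = 1`. -/
theorem exists_isCritical_of_rootCheck {D T : ℕ} {lo hi : List ℕ} {t : Fin 8 → ℝ} (hok : boxOKc D lo hi = true)
    (hT : 0 < T) (h : t ∈ LemmaFBox.box D lo hi) (ht0 : t 0 = 1) {rd : RootData} {l u : ℤ}
    (hrc : rootCheck D T lo hi rd = some (l, u)) :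
    ∃ x y : ℝ, IsCritical (aOfS t) x y ∧
      (l : ℝ) ≤ growthLogR (pR (aOfS t)) (qR (aOfS t)) x y * SC ∧
      growthLogR (pR (aOfS t)) (qR (aOfS t)) x y * SC ≤ (u : ℝ) := by
  have hD : 0 < D := by
    have := hok; simp only [boxOKc, decide_eq_true_eq] at this; exact this.1
  set Qn : ℕ := 2 * D * T with hQn
  have hQ : 0 < Qn := by rw [hQn]; positivity
  -- unpack the checker
  unfold rootCheck at hrc
  dsimp only at hrc
  split at hrc
  · rename_i hcond
    obtain ⟨hface, _, _, hwx, hwv, hZsign, hdet⟩ := hcond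
    split at hrc
    · rename_i G hG
      simp only [Option.some.injEq, Prod.mk.injEq] at hrc
      obtain ⟨rfl, rfl⟩ := hrc
      -- Miranda
      obtain ⟨η₁, η₂, hη₁, hη₂, hzero⟩ := exists_zero_of_faceCheck hok hT h ht0 hface hwx hwv hdet
      have hv := valid_noise hok h hη₁ hη₂
      set ε := noise D lo hi t η₁ η₂ with hε
      set P := boxPt D T lo hi rd t η₁ η₂ with hP
      have htA := tAF_mem hok h ht0 hη₁ hη₂
      have hQc : ((Qn : ℕ) : ℝ) = 2 * (D : ℝ) * T := by rw [hQn]; push_cast; ring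
      have hX : mem SC ε P.1 (coordAF rd.cx rd.ax rd.wx 8 Qn) := by
        have := coordAF_mem hv rd.cx rd.ax rd.wx hQ 8 (Or.inl rfl)
        rw [hQc] at this
        simpa [hP, boxPt, hε, noise] using this
      have hV : mem SC ε P.2 (coordAF rd.cv rd.av rd.wv 9 Qn) := by
        have := coordAF_mem hv rd.cv rd.av rd.wv hQ 9 (Or.inr rfl)
        rw [hQc] at this
        simpa [hP, boxPt, hε, noise] using this
      unfold valueAF at hG
      by_cases hfar : rd.far = true
      swap
      · -- near chart: `(x, y) = (X + t₆, Y + t₆)`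
        have hfar' : rd.far = false := Bool.eq_false_iff.mpr hfar
        rw [hfar'] at hG hzero
        simp only [Bool.false_eq_true, if_false] at hG
        have hF := forall₂_zip (coefs_forall₂ htA) (argsNear_forall₂ htA hX hV)
        have hall := List.rel_append hF (constTerms_forall₂ htA)
        obtain ⟨hne, hmem⟩ := logSum_mem hv _ _ hall hG
        refine ⟨P.1 + t 6, P.2 + t 6, ⟨?_, ?_, ?_⟩, ?_, ?_⟩
        · have := congrArg Prod.fst hzero; simpa [sysR] using this
        · have := congrArg Prod.snd hzero; simpa [sysR] using this
        · intro k
          rw [critFactors_near]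
          have hk : ((argsNearR t P.1 P.2).getD k 0, 0) = ((argsNearR t P.1 P.2).getD k 0, 0) := rfl
          have hlen : (argsNearR t P.1 P.2).length = 12 := by simp [argsNearR]
          have hmemk : (argsNearR t P.1 P.2).getD k 0 ∈ argsNearR t P.1 P.2 := by
            rw [List.getD_eq_getElem _ _ (by rw [hlen]; exact k.isLt)]
            exact List.getElem_mem _
          -- the k-th argument is the second component of an element of the zipped list
          have hlenc : (coefsR t).length = 12 := by simp [coefsR]
          obtain ⟨i, hi, hgi⟩ := List.getElem_of_mem hmemk
          have hz : ((coefsR t)[i]'(by rw [hlenc]; rw [hlen] at hi; exact hi), (argsNearR t P.1 P.2)[i]) ∈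
              ((coefsR t).zip (argsNearR t P.1 P.2)) ++ constTermsR t := by
            apply List.mem_append_left
            rw [List.mem_iff_getElem]
            refine ⟨i, by simp [hlenc, hlen]; rw [hlen] at hi; exact hi, ?_⟩
            simp
          have := hne _ hz
          simpa [hgi] using this
        · rw [growthLogR_near]; exact lo_le hv hmem
        · rw [growthLogR_near]; exact le_hi hv hmem
      · -- far chart: `(x, y) = (X + t₆, 1/Z + t₆)`
        rw [hfar] at hG hzero hZsign
        simp only [if_true] at hG
        have hZ : P.2 ≠ 0 := by
          rcases hZsign rfl with hneg | hpos
          · have hn : mem SC ε (-P.2) (neg (coordAF rd.cv rd.av rd.wv 9 Qn)) := mem_neg hV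
            have hr : (rad (neg (coordAF rd.cv rd.av rd.wv 9 Qn)) : ℤ) < (neg (coordAF rd.cv rd.av rd.wv 9 Qn)).c := by
              have key : ∀ F : AForm, rad (neg F) = rad F ∧ (neg F).c = -F.c := by
                intro F
                refine ⟨?_, by simp [neg, mulInt]⟩
                have kk : ∀ l : List ℤ, absSum (l.map (fun x => -1 * x)) = absSum l := by
                  intro l; induction l with
                  | nil => rfl
                  | cons b l ih => rw [List.map_cons, absSum, absSum, ih, neg_one_mul, Int.natAbs_neg]
                simp only [rad, neg, mulInt, Int.natAbs_neg, Int.natAbs_one, one_mul, kk]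
              rw [(key _).1, (key _).2]; exact hneg
            have := pos_of_rad_lt SC_pos hv hr hn
            linarith
          · exact (pos_of_rad_lt SC_pos hv hpos hV).ne'
        have hF := forall₂_zip (coefs_forall₂ htA) (argsFar_forall₂ hv htA hX hV)
        have hall := List.rel_append hF (constTerms_forall₂ htA)
        obtain ⟨hne, hmem⟩ := logSum_mem hv _ _ hall hG
        have hnum : ∀ r ∈ argsFarR t P.1 P.2, r ≠ 0 := by
          intro r hr
          have hlen : (argsFarR t P.1 P.2).length = 12 := by simp [argsFarR]
          have hlenc : (coefsR t).length = 12 := by simp [coefsR]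
          obtain ⟨i, hi, hgi⟩ := List.getElem_of_mem hr
          have hz : ((coefsR t)[i]'(by rw [hlenc]; rw [hlen] at hi; exact hi), (argsFarR t P.1 P.2)[i]) ∈
              ((coefsR t).zip (argsFarR t P.1 P.2)) ++ constTermsR t := by
            apply List.mem_append_left
            rw [List.mem_iff_getElem]
            refine ⟨i, by simp [hlenc, hlen]; rw [hlen] at hi; exact hi, ?_⟩
            simp
          have := hne _ hz
          simpa [hgi] using this
        have hG1 : G1R t P.1 P.2 = 0 := by have := congrArg Prod.fst hzero; simpa [sysR] using this
        have hG2 : G2R t P.1 P.2 = 0 := by have := congrArg Prod.snd hzero; simpa [sysR] using this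
        refine ⟨P.1 + t 6, P.2⁻¹ + t 6, ⟨?_, ?_, critFactors_far_ne_zero t P.1 hZ hnum⟩, ?_, ?_⟩
        · have := G1R_eq t P.1 hZ; rw [hG1] at this
          exact (mul_eq_zero.1 this.symm).resolve_left hZ
        · have := G2R_eq t P.1 hZ; rw [hG2] at this
          exact (mul_eq_zero.1 this.symm).resolve_left (pow_ne_zero 2 hZ)
        · rw [growthLogR_far t P.1 hZ hnum]; exact lo_le hv hmem
        · rw [growthLogR_far t P.1 hZ hnum]; exact le_hi hv hmem
    · exact absurd hrc (by simp)
  · exact absurd hrc (by simp)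

end CritBox

end Summit.KontsevichZagierPeriods.Zeta5Search.Barrier.ConeGamma

end
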